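import Literature.Probability.Moments.NoiseDilution
import Literature.Barriers.PneNP.HadamardNotRigidProofs
import HarnessLib

/-!
# The first `2^k` Hadamard vectors: `ZZᵀ` is supported on the diagonals `i·2^k`, so probing a
# trace with them is (scaled) dilution by the residue `i mod 2^k`, and the full set is `HHᵀ = N·I`

Topic `Probability/Moments`; sequel of `NoiseDilution.lean` (`dilutedTraceEst c A z`, the block
mask) and companion of `ProbingTraceEstimator.lean` (Bekas–Kokiopoulou–Saad Prop. 2.1,
Stathopoulos–Laeuchli–Orginos Prop. 1.2: exactness when probe rows are orthogonal on the pattern).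
The Hadamard matrix is the tree's `Literature.Barriers.PneNP.walshHadamard K n`
(`H_n(i,j) = (−1)^{⟨bits i, bits j⟩}` on `Fin 2ⁿ`, natural = Sylvester ordering), which is
literally the printed `H_n(i,j) = (−1)^{Σ_k i_k j_k}`.  PUBLISHED RESULTS with our proof; no
public definition beyond the probe matrix `hadamardPrefix` and the residue scheme `residueColor`
(`lowBits` is private plumbing), no named fact (D-0026).

HONEST FRAMING: exact (Metropolis-corrected) sampling algorithms for lattice gauge theory;
figures of merit are autocorrelation/cost numbers at stated couplings and volumes; no
continuum-physics claim.

## Sources (read on the materialised texts) and what is taken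

* A. Stathopoulos, J. Laeuchli, K. Orginos, SIAM J. Sci. Comput. 35 (2013) S299–S322 =
  arXiv:1302.4018 [StathopoulosLaeuchliOrginos2013] (held text `paper:arxiv-1302.4018`, p0003,
  p0006), §1.1.4 "Hadamard vectors": "An `N×N` matrix `H` is a Hadamard matrix of order `N` if it
  has entries `H(i,j) = ±1` and `HHᵀ = NI` … For powers of two … its elements can be obtained
  directly as `H_n(i,j) = (−1)^{Σ_{k=1}^{log N} i_k j_k}`, where `(i_{log N},…,i_1)_2` and
  `(j_{log N},…,j_1)_2` are the binary representations of `i−1` and `j−1`" and "**Consider the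
  first `2^k` columns of a Hadamard matrix `Z = H(:,1:2^k)`. The non-zero pattern of the matrix
  `ZZᵀ` consists of the `i2^k` upper and lower diagonals, `i = 0,1,…`** [Bekas_diagonal]. Because
  `Tr(ZᵀA⁻¹Z) = Tr(A⁻¹ZZᵀ)` … the error in the MC estimation of the trace is induced only by the
  off-diagonal elements of `A⁻¹` that appear on the same locations as the non-zero diagonals of
  `ZZᵀ`. If the matrix is banded or its diagonals do not coincide with the ones of `ZZᵀ`, the
  trace estimation is exact. … this special structure of `ZZᵀ` is achieved only when the number
  of vectors, `s`, is a power of two"; §1 (p0003): "if we use the first `2^m` Hadamard vectors,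
  the error in the trace approximation comes only from non-zero elements on the (`k2^m`)th matrix
  diagonal, `k = 1,…,N/2^m`."; §4 (p0014) "Removing the deterministic bias": "consider a random
  vector `z_0 ∈ Z_2^N` … the vectors built as `V = [z_0 ⊙ z_1, z_0 ⊙ z_2, …, z_0 ⊙ z_m]` have the
  same properties as `Z`, i.e., `VᵀV = ZᵀZ` and `VVᵀ` has same non-zero pattern as `ZZᵀ`
  (`VVᵀ = (z_0z_0ᵀ) ⊙ ZZᵀ`), but it does not have the bias."
* C. Bekas, E. Kokiopoulou, Y. Saad, Appl. Numer. Math. 57 (2007) 1214–1229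
  [BekasKokiopoulouSaad2007] (held text, pp. 7–8), §2.4 Definition 2.1 (`HHᵀ = nI`) and the
  discussion of Fig. 2: "Proposition 2.2 suggests that if we were to use all rows of the Hadamard
  matrix …, then `VVᵀ = nI`. Thus, the estimator will yield exactly the diagonal … In the diagonal
  estimator the error will be induced by off-diagonal entries of the original matrix `A` that
  occupy the diagonals illustrated in plots of Figure 2."

## What is formalised (`N = 2ⁿ`, indices `i : Fin 2ⁿ` = the printed `i − 1`; `k ≤ n`)

* `hadamardPrefix n k` — the probe matrix `Z = H(:, 1:2^k)` (`Fin 2ⁿ × Fin 2^k`, entries `±1`);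
  `residueColor n k` — the scheme `i ↦ i mod 2^k`.
* **`sum_prefix_walshHadamard_mul`** / **`hadamardPrefix_mul_transpose_apply`** — the STRUCTURE
  THEOREM: `(ZZᵀ)_{il} = 2^k` if `i ≡ l (mod 2^k)` and `0` otherwise (the diagonals `i·2^k`).
* **`walshHadamard_mul_transpose`** — the case `k = n`: `HHᵀ = 2ⁿ·I` (Hadamard property).
* **`sum_traceEst_hadamardPrefix`** — probing `tr A` with the first `2^k` Hadamard vectors is
  `2^k ×` the diluted estimator of the residue scheme `i ↦ i mod 2^k` at the all-ones vector:
  `Σ_{j<2^k} h_jᵀ A h_j = 2^k (tr A + Σ_{i≠l, i≡l (2^k)} A_il)` — "the error … comes only from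
  non-zero elements on the (`k2^m`)th matrix diagonal"; `avg_traceEst_hadamardPrefix_eq_trace` —
  exact when `A` vanishes on those diagonals.
* §4 "Removing the deterministic bias": for `V = [z ⊙ h_j]_{j<2^k}`, `VVᵀ = (zzᵀ) ⊙ ZZᵀ`
  (`signed_hadamardPrefix_mul_transpose_apply`), **`sum_traceEst_signed_hadamardPrefix`**
  (`Σ_j (z ⊙ h_j)ᵀA(z ⊙ h_j) = 2^k ·` the diluted estimator of the residue scheme AT `z`), hence
  **`integral_sum_traceEst_signed_hadamardPrefix`**: unbiased (`= 2^k tr A` in the mean) for i.i.d.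
  unit noise `z`, by `NoiseDilution.integral_dilutedTraceEst`.

NOT formalised: `2^k < s < 2^{k+1}` ("dense in general"), the Fourier vectors `F_n`, and the
hierarchical permutations of §§2–4.
-/

noncomputable section

open Finset
open scoped Matrix

namespace Literature.Probability.Moments

namespace StochasticTrace

namespace HadamardProbing

open Dilution Literature.Barriers.PneNP

/-! ## The character sum over the subsets of the low bits -/

/-- The character sum behind the Hadamard prefix structure: for `S, S' ⊆ Fin n` and a set of
positions `L`, `Σ_{T ⊆ L} (−1)^{|S∩T|}(−1)^{|S'∩T|} = 2^{|L|}` if `S` and `S'` agree on `L`, and `0`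
otherwise (each position `a ∈ L` contributes a factor `1 + (−1)^{[a∈S]+[a∈S']}`). [folklore] -/
private theorem sum_powerset_neg_one_pow_inter {n : ℕ} (S S' L : Finset (Fin n)) :
    ∑ T ∈ L.powerset, ((-1 : ℝ) ^ (S ∩ T).card * (-1 : ℝ) ^ (S' ∩ T).card) =
      if ∀ a ∈ L, (a ∈ S ↔ a ∈ S') then (2 : ℝ) ^ L.card else 0 := by
  induction L using Finset.induction_on with
  | empty => simp
  | @insert a L ha ih =>
    rw [Finset.sum_powerset_insert ha]
    have hins : ∀ T ∈ L.powerset,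
        ((-1 : ℝ) ^ (S ∩ insert a T).card * (-1 : ℝ) ^ (S' ∩ insert a T).card)
        = ((if a ∈ S then -1 else 1) * (if a ∈ S' then -1 else 1)) *
          ((-1 : ℝ) ^ (S ∩ T).card * (-1 : ℝ) ^ (S' ∩ T).card) := by
      intro T hT
      have haT : a ∉ T := fun h => ha (Finset.mem_powerset.mp hT h)
      have hS : (S ∩ insert a T).card = (S ∩ T).card + (if a ∈ S then 1 else 0) := by
        by_cases h : a ∈ S
        · rw [Finset.inter_insert_of_mem h, Finset.card_insert_of_notMem (fun h' => haT
            (Finset.mem_inter.mp h').2), if_pos h]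
        · rw [Finset.inter_insert_of_notMem h, if_neg h, add_zero]
      have hS' : (S' ∩ insert a T).card = (S' ∩ T).card + (if a ∈ S' then 1 else 0) := by
        by_cases h : a ∈ S'
        · rw [Finset.inter_insert_of_mem h, Finset.card_insert_of_notMem (fun h' => haT
            (Finset.mem_inter.mp h').2), if_pos h]
        · rw [Finset.inter_insert_of_notMem h, if_neg h, add_zero]
      rw [hS, hS', pow_add, pow_add]
      by_cases h1 : a ∈ S <;> by_cases h2 : a ∈ S' <;> simp [h1, h2]
    rw [Finset.sum_congr rfl hins, ← Finset.mul_sum, ih]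
    by_cases hL : ∀ b ∈ L, (b ∈ S ↔ b ∈ S')
    · rw [if_pos hL]
      by_cases hagree : (a ∈ S ↔ a ∈ S')
      · have hall : ∀ b ∈ insert a L, (b ∈ S ↔ b ∈ S') := by
          intro b hb
          rcases Finset.mem_insert.mp hb with rfl | hb
          · exact hagree
          · exact hL b hb
        have hfac : ((if a ∈ S then (-1 : ℝ) else 1) * (if a ∈ S' then (-1 : ℝ) else 1)) = 1 := by
          by_cases h1 : a ∈ S
          · rw [if_pos h1, if_pos (hagree.mp h1)]; norm_num
          · rw [if_neg h1, if_neg (fun h => h1 (hagree.mpr h))]; norm_num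
        rw [if_pos hall, Finset.card_insert_of_notMem ha, pow_succ, hfac]
        ring
      · have hnall : ¬ ∀ b ∈ insert a L, (b ∈ S ↔ b ∈ S') :=
          fun h => hagree (h a (Finset.mem_insert_self a L))
        have hfac : ((if a ∈ S then (-1 : ℝ) else 1) * (if a ∈ S' then (-1 : ℝ) else 1)) = -1 := by
          by_cases h1 : a ∈ S
          · have h2 : a ∉ S' := fun h => hagree ⟨fun _ => h, fun _ => h1⟩
            rw [if_pos h1, if_neg h2]; norm_num
          · have h2 : a ∈ S' := by
              by_contra h
              exact hagree ⟨fun h' => (h1 h').elim, fun h' => (h h').elim⟩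
            rw [if_neg h1, if_pos h2]; norm_num
        rw [if_neg hnall, hfac]
        ring
    · have hnall : ¬ ∀ b ∈ insert a L, (b ∈ S ↔ b ∈ S') :=
        fun h => hL fun b hb => h b (Finset.mem_insert_of_mem hb)
      rw [if_neg hL, if_neg hnall, mul_zero, add_zero]

/-! ## Low bits: `j < 2^k` and `i ≡ l (mod 2^k)` through `bitsEquiv` -/

/-- The positions below `k`. [folklore] -/
private def lowBits (n k : ℕ) : Finset (Fin n) := univ.filter fun t : Fin n => t.val < k

/-- `j < 2^k` iff all `1`-bits of `j` lie below `k` (for `j < 2ⁿ`, `k ≤ n`). [folklore] -/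
private theorem lt_two_pow_iff_bits_subset {n : ℕ} (k : ℕ) (j : Fin (2 ^ n)) :
    j.val < 2 ^ k ↔ bitsEquiv n j ⊆ lowBits n k := by
  simp only [bitsEquiv, Equiv.ofBijective_apply, bitsOf, lowBits, Finset.subset_iff,
    Finset.mem_filter, Finset.mem_univ, true_and]
  constructor
  · intro hj t ht
    by_contra hlt
    have : j.val.testBit t = false :=
      Nat.testBit_lt_two_pow (hj.trans_le (Nat.pow_le_pow_right two_pos (not_lt.mp hlt)))
    rw [this] at ht
    exact Bool.false_ne_true ht
  · intro h
    apply Nat.lt_pow_two_of_testBit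
    intro t ht
    by_cases htn : t < n
    · by_contra hb
      have hb' : j.val.testBit t = true := by
        cases h' : j.val.testBit t
        · exact (hb h').elim
        · rfl
      have hlt : (⟨t, htn⟩ : Fin n).val < k := h hb'
      exact absurd hlt (not_lt.mpr ht)
    · exact Nat.testBit_lt_two_pow (j.isLt.trans_le (Nat.pow_le_pow_right two_pos (not_lt.mp htn)))

/-- `i ≡ l (mod 2^k)` iff the bit sets of `i` and `l` agree below `k` (`k ≤ n`). [folklore] -/
private theorem mod_two_pow_eq_iff_bits_agree {n k : ℕ} (hk : k ≤ n) (i l : Fin (2 ^ n)) :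
    i.val % 2 ^ k = l.val % 2 ^ k ↔
      ∀ a ∈ lowBits n k, (a ∈ bitsEquiv n i ↔ a ∈ bitsEquiv n l) := by
  simp only [bitsEquiv, Equiv.ofBijective_apply, bitsOf, lowBits, Finset.mem_filter,
    Finset.mem_univ, true_and]
  constructor
  · intro h a ha
    have := congrArg (fun x => Nat.testBit x a.val) h
    simp only [Nat.testBit_mod_two_pow, ha, decide_true, Bool.true_and] at this
    rw [this]
  · intro h
    apply Nat.eq_of_testBit_eq
    intro t
    rw [Nat.testBit_mod_two_pow, Nat.testBit_mod_two_pow]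
    by_cases ht : t < k
    · have htn : t < n := lt_of_lt_of_le ht hk
      have := h ⟨t, htn⟩ ht
      simp only [ht, decide_true, Bool.true_and]
      rcases hi : i.val.testBit t <;> rcases hl : l.val.testBit t <;> simp_all
    · simp [ht]

/-! ## The structure theorem for the first `2^k` Hadamard columns -/

/-- Entries of the tree's Walsh–Hadamard matrix through bit sets:
`H(i,j) = (−1)^{|bits i ∩ bits j|}`
— the printed `H_n(i,j) = (−1)^{Σ_k i_k j_k}`. [cite: StathopoulosLaeuchliOrginos2013, §1.1.4
eq. (Hadamard elements)] -/
theorem walshHadamard_apply_eq (n : ℕ) (i j : Fin (2 ^ n)) :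
    walshHadamard ℝ n i j = (-1 : ℝ) ^ (bitsEquiv n i ∩ bitsEquiv n j).card := by
  rw [walshHadamard, bitInner_eq_card_inter]

/-- **STRUCTURE OF `ZZᵀ` FOR `Z = H(:, 1:2^k)`** ("The non-zero pattern of the matrix `ZZᵀ`
consists of the `i2^k` upper and lower diagonals, `i = 0, 1, …`"): for `k ≤ n` and rows `i, l`,
`Σ_{j < 2^k} H(i,j) H(l,j) = 2^k` if `i ≡ l (mod 2^k)` and `= 0` otherwise.
[cite: StathopoulosLaeuchliOrginos2013, §1.1.4 (paragraph "Consider the first `2^k` columns")];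
[cite: BekasKokiopoulouSaad2007, §2.4 (Fig. 2 and its discussion)] -/
theorem sum_prefix_walshHadamard_mul {n k : ℕ} (hk : k ≤ n) (i l : Fin (2 ^ n)) :
    ∑ j ∈ univ.filter (fun j : Fin (2 ^ n) => j.val < 2 ^ k),
        walshHadamard ℝ n i j * walshHadamard ℝ n l j =
      if i.val % 2 ^ k = l.val % 2 ^ k then (2 : ℝ) ^ k else 0 := by
  have hre : ∑ j ∈ univ.filter (fun j : Fin (2 ^ n) => j.val < 2 ^ k),
      walshHadamard ℝ n i j * walshHadamard ℝ n l j =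
      ∑ T ∈ (lowBits n k).powerset,
        ((-1 : ℝ) ^ (bitsEquiv n i ∩ T).card * (-1 : ℝ) ^ (bitsEquiv n l ∩ T).card) := by
    refine Finset.sum_equiv (bitsEquiv n) (fun j => ?_) (fun j _ => ?_)
    · rw [Finset.mem_filter, Finset.mem_powerset, lt_two_pow_iff_bits_subset k j]
      simp
    · rw [walshHadamard_apply_eq, walshHadamard_apply_eq]
  have hcard' : (lowBits n k).card = (Finset.range k).card := by
    refine Finset.card_bij (fun t _ => t.val) (fun t ht => ?_) (fun t₁ _ t₂ _ h => Fin.ext h)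
      (fun m hm => ?_)
    · exact Finset.mem_range.mpr (Finset.mem_filter.mp ht).2
    · exact ⟨⟨m, lt_of_lt_of_le (Finset.mem_range.mp hm) hk⟩,
        Finset.mem_filter.mpr ⟨Finset.mem_univ _, Finset.mem_range.mp hm⟩, rfl⟩
  have hcard : (lowBits n k).card = k := by rw [hcard', Finset.card_range]
  rw [hre, sum_powerset_neg_one_pow_inter, hcard]
  by_cases h : i.val % 2 ^ k = l.val % 2 ^ k
  · rw [if_pos h, if_pos ((mod_two_pow_eq_iff_bits_agree hk i l).mp h)]
  · rw [if_neg h, if_neg (fun h' => h ((mod_two_pow_eq_iff_bits_agree hk i l).mpr h'))]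

/-- **The Hadamard property `HHᵀ = N·I`** (`N = 2ⁿ`; the case `k = n` of the structure theorem —
"if we were to use all rows of the Hadamard matrix …, then `VVᵀ = nI`"; cf.
`IQPAnticoncentration.walshHadamard_mul_self` for the `𝔽₂^V`-indexed matrix of the same name).
[cite: StathopoulosLaeuchliOrginos2013, §1.1.4 (definition, `HHᵀ = NI`)];
[cite: BekasKokiopoulouSaad2007, §2.4 Definition 2.1] -/
theorem walshHadamard_mul_transpose (n : ℕ) :
    walshHadamard ℝ n * (walshHadamard ℝ n)ᵀ =
      (2 : ℝ) ^ n • (1 : Matrix (Fin (2 ^ n)) (Fin (2 ^ n)) ℝ) := by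
  ext i l
  rw [Matrix.mul_apply, Matrix.smul_apply, smul_eq_mul]
  have h := sum_prefix_walshHadamard_mul le_rfl i l
  have hfilt : univ.filter (fun j : Fin (2 ^ n) => j.val < 2 ^ n) = univ :=
    Finset.filter_true_of_mem fun j _ => j.isLt
  rw [hfilt] at h
  simp only [Matrix.transpose_apply]
  rw [h, Nat.mod_eq_of_lt i.isLt, Nat.mod_eq_of_lt l.isLt]
  by_cases hil : i = l
  · subst hil; simp
  · rw [if_neg (fun e => hil (Fin.ext e)), Matrix.one_apply_ne hil, mul_zero]

/-! ## The prefix probe matrix and the trace estimator -/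

/-- The PROBE MATRIX `Z = H(:, 1:2^k)` of the first `2^k` Hadamard vectors `h_0, …, h_{2^k−1}`
(`k ≤ n`; column `j < 2^k` of `H_{2ⁿ}`). [cite: StathopoulosLaeuchliOrginos2013, §1.1.4
(`h_j = H_n(:, j+1)`, `Z = H(:,1:2^k)`)] -/
def hadamardPrefix (n k : ℕ) (hk : k ≤ n) : Matrix (Fin (2 ^ n)) (Fin (2 ^ k)) ℝ :=
  Matrix.of fun i j =>
    walshHadamard ℝ n i ⟨j.val, j.isLt.trans_le (Nat.pow_le_pow_right two_pos hk)⟩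

/-- The RESIDUE SCHEME `i ↦ i mod 2^k` (as an element of `Fin 2^k`): the dilution/colouring that
the first `2^k` Hadamard vectors realise. [cite: StathopoulosLaeuchliOrginos2013, §1.1.4
(diagonals `i2^k` of `ZZᵀ`)] -/
def residueColor (n k : ℕ) (i : Fin (2 ^ n)) : Fin (2 ^ k) :=
  ⟨i.val % 2 ^ k, Nat.mod_lt _ (Nat.two_pow_pos k)⟩

/-- Two indices get the same residue colour iff `i ≡ l (mod 2^k)`.
[cite: StathopoulosLaeuchliOrginos2013, §1.1.4] -/
theorem residueColor_eq_iff {n k : ℕ} {i l : Fin (2 ^ n)} :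
    residueColor n k i = residueColor n k l ↔ i.val % 2 ^ k = l.val % 2 ^ k := by
  simp [residueColor, Fin.ext_iff]

/-- **`(ZZᵀ)_{il} = 2^k · [i ≡ l (mod 2^k)]`** for the prefix probe matrix.
[cite: StathopoulosLaeuchliOrginos2013, §1.1.4 (non-zero pattern of `ZZᵀ`)] -/
theorem hadamardPrefix_mul_transpose_apply {n k : ℕ} (hk : k ≤ n) (i l : Fin (2 ^ n)) :
    (hadamardPrefix n k hk * (hadamardPrefix n k hk)ᵀ) i l =
      if i.val % 2 ^ k = l.val % 2 ^ k then (2 : ℝ) ^ k else 0 := by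
  rw [Matrix.mul_apply, ← sum_prefix_walshHadamard_mul hk i l]
  simp only [Matrix.transpose_apply, hadamardPrefix, Matrix.of_apply]
  -- reindex `Fin (2^k)` ≃ `{j : Fin (2^n) | j < 2^k}`
  refine Finset.sum_bij (fun (j : Fin (2 ^ k)) _ =>
      (⟨j.val, j.isLt.trans_le (Nat.pow_le_pow_right two_pos hk)⟩ : Fin (2 ^ n))) ?_ ?_ ?_ ?_
  · intro j _; simp [j.isLt]
  · intro j _ j' _ h; exact Fin.ext (by simpa using congrArg Fin.val h)
  · intro j hj
    refine ⟨⟨j.val, (Finset.mem_filter.mp hj).2⟩, Finset.mem_univ _, Fin.ext rfl⟩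
  · intro j _; rfl

/-- Entries of the prefix probe matrix are `±1`. [cite: StathopoulosLaeuchliOrginos2013, §1.1.4
("entries `H(i,j) = ±1`")] -/
theorem hadamardPrefix_sq {n k : ℕ} (hk : k ≤ n) (i : Fin (2 ^ n)) (j : Fin (2 ^ k)) :
    hadamardPrefix n k hk i j ^ 2 = 1 := by
  simp only [hadamardPrefix, Matrix.of_apply]
  exact walshHadamard_apply_sq ℝ n _ _

/-- `Σ_j z_jᵀ A z_j = Σ_{i,l} A_il (ZZᵀ)_il` ("`Tr(ZᵀAZ) = Tr(AZZᵀ)`"), for any real probe matrix.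
[cite: StathopoulosLaeuchliOrginos2013, §1.1.4 ("Because `Tr(ZᵀA⁻¹Z) = Tr(A⁻¹ZZᵀ)`")] -/
theorem sum_traceEst_col_eq {m : Type*} [Fintype m] {κ : Type*} [Fintype κ]
    (A : Matrix m m ℝ) (V : Matrix m κ ℝ) :
    ∑ j, traceEst A (fun i => V i j) = ∑ i, ∑ l, A i l * (V * Vᵀ) i l := by
  unfold traceEst
  rw [Finset.sum_comm]
  refine Finset.sum_congr rfl fun i _ => ?_
  rw [Finset.sum_comm]
  refine Finset.sum_congr rfl fun l _ => ?_
  rw [Matrix.mul_apply, Finset.mul_sum]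
  simp only [Matrix.transpose_apply]

/-- **Probing with the first `2^k` Hadamard vectors is `2^k ×` dilution by the residue scheme
`i ↦ i mod 2^k` at the all-ones vector**: `Σ_{j<2^k} h_jᵀ A h_j = 2^k · Σ_{i ≡ l (2^k)} A_il`
— the estimate `2^{−k} Σ_j h_jᵀAh_j` equals `tr A` plus the entries of `A` on the diagonals
`i·2^k`, `i ≥ 1` ("the error in the trace approximation comes only from non-zero elements on the
(`k2^m`)th matrix diagonal"). [cite: StathopoulosLaeuchliOrginos2013, §1 (p. 2, "if we use the first
`2^m` Hadamard vectors") and §1.1.4] -/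
theorem sum_traceEst_hadamardPrefix {n k : ℕ} (hk : k ≤ n)
    (A : Matrix (Fin (2 ^ n)) (Fin (2 ^ n)) ℝ) :
    ∑ j, traceEst A (fun i => hadamardPrefix n k hk i j) =
      (2 : ℝ) ^ k * dilutedTraceEst (residueColor n k) A (fun _ => 1) := by
  rw [sum_traceEst_col_eq, dilutedTraceEst_eq]
  unfold traceEst
  rw [Finset.mul_sum]
  refine Finset.sum_congr rfl fun i _ => ?_
  rw [Finset.mul_sum]
  refine Finset.sum_congr rfl fun l _ => ?_
  rw [hadamardPrefix_mul_transpose_apply hk, blockMask_apply]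
  simp only [residueColor_eq_iff]
  split_ifs <;> ring

/-- **Exactness off the diagonals `i·2^k`**: if `A_il = 0` whenever `i ≠ l` and
`i ≡ l (mod 2^k)` ("if the matrix is banded [with half-bandwidth `< 2^k`] or its diagonals do not
coincide with the ones of `ZZᵀ`"), then `2^{−k} Σ_{j<2^k} h_jᵀ A h_j = tr A` exactly.
[cite: StathopoulosLaeuchliOrginos2013, §1.1.4 ("the trace estimation is exact")] -/
theorem avg_traceEst_hadamardPrefix_eq_trace {n k : ℕ} (hk : k ≤ n)
    {A : Matrix (Fin (2 ^ n)) (Fin (2 ^ n)) ℝ}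
    (hA : ∀ i l, i ≠ l → i.val % 2 ^ k = l.val % 2 ^ k → A i l = 0) :
    (∑ j, traceEst A (fun i => hadamardPrefix n k hk i j)) / (2 : ℝ) ^ k = A.trace := by
  rw [sum_traceEst_hadamardPrefix hk, mul_div_cancel_left₀ _ (pow_ne_zero k two_ne_zero),
    dilutedTraceEst_eq]
  unfold traceEst
  rw [Matrix.trace]
  refine Finset.sum_congr rfl fun i _ => ?_
  rw [Finset.sum_eq_single i]
  · simp
  · intro l _ hli
    rw [blockMask_apply]
    by_cases h : residueColor n k i = residueColor n k l
    · rw [if_pos h, hA i l (Ne.symm hli) (residueColor_eq_iff.mp h), zero_mul]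
    · rw [if_neg h, zero_mul]
  · intro h; exact (h (Finset.mem_univ i)).elim

/-! ## Removing the deterministic bias (SLO §4): `V = [z ⊙ h_0, …, z ⊙ h_{2^k−1}]` -/

/-- **`VVᵀ = (zzᵀ) ⊙ ZZᵀ`** for the sign-modulated prefix `V = [z ⊙ h_j]_j` ("the vectors built as
`V = [z_0 ⊙ z_1, …, z_0 ⊙ z_m]` have the same properties as `Z`, i.e. … `VVᵀ` has same non-zero
pattern as `ZZᵀ` (`VVᵀ = (z_0z_0ᵀ) ⊙ ZZᵀ`)"). [cite: StathopoulosLaeuchliOrginos2013, §4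
eq. (removebias)] -/
theorem signed_hadamardPrefix_mul_transpose_apply {n k : ℕ} (hk : k ≤ n)
    (z : Fin (2 ^ n) → ℝ) (i l : Fin (2 ^ n)) :
    (Matrix.of (fun i j => z i * hadamardPrefix n k hk i j) *
        (Matrix.of fun i j => z i * hadamardPrefix n k hk i j)ᵀ) i l =
      z i * z l * (if i.val % 2 ^ k = l.val % 2 ^ k then (2 : ℝ) ^ k else 0) := by
  rw [← hadamardPrefix_mul_transpose_apply hk i l, Matrix.mul_apply, Matrix.mul_apply,
    Finset.mul_sum]
  refine Finset.sum_congr rfl fun j _ => ?_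
  simp only [Matrix.of_apply, Matrix.transpose_apply]
  ring

/-- **The sign-modulated Hadamard prefix is `2^k ×` dilution of the noise vector `z` by the
residue scheme**: `Σ_{j<2^k} (z ⊙ h_j)ᵀ A (z ⊙ h_j) = 2^k · Σ_b (P^{(b)}z)ᵀ A (P^{(b)}z)` with
the blocks `b = i mod 2^k` — so with a random `z ∈ Z_2^N` it "does not have the bias".
[cite: StathopoulosLaeuchliOrginos2013, §4 eq. (removebias)] -/
theorem sum_traceEst_signed_hadamardPrefix {n k : ℕ} (hk : k ≤ n)
    (A : Matrix (Fin (2 ^ n)) (Fin (2 ^ n)) ℝ) (z : Fin (2 ^ n) → ℝ) :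
    ∑ j, traceEst A (fun i => z i * hadamardPrefix n k hk i j) =
      (2 : ℝ) ^ k * dilutedTraceEst (residueColor n k) A z := by
  have h := sum_traceEst_col_eq A (Matrix.of fun i j => z i * hadamardPrefix n k hk i j)
  simp only [Matrix.of_apply] at h
  rw [h, dilutedTraceEst_eq]
  unfold traceEst
  rw [Finset.mul_sum]
  refine Finset.sum_congr rfl fun i _ => ?_
  rw [Finset.mul_sum]
  refine Finset.sum_congr rfl fun l _ => ?_
  have h2 := signed_hadamardPrefix_mul_transpose_apply hk z i l
  simp only [Matrix.mul_apply, Matrix.of_apply, Matrix.transpose_apply] at h2 ⊢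
  rw [h2, blockMask_apply]
  simp only [residueColor_eq_iff]
  split_ifs <;> ring

/-- **UNBIASEDNESS after sign modulation** ("but it does not have the bias"): for i.i.d. unit
noise `z` (e.g. `Z_2`), `E[Σ_{j<2^k} (z ⊙ h_j)ᵀ A (z ⊙ h_j)] = 2^k · tr A` — by the unbiasedness of
the diluted estimator (`NoiseDilution.integral_dilutedTraceEst`).
[cite: StathopoulosLaeuchliOrginos2013, §4 eq. (removebias)] -/
theorem integral_sum_traceEst_signed_hadamardPrefix {μ : MeasureTheory.Measure ℝ}
    [MeasureTheory.IsProbabilityMeasure μ] (hμ : IsUnitNoise μ) {n k : ℕ} (hk : k ≤ n)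
    (A : Matrix (Fin (2 ^ n)) (Fin (2 ^ n)) ℝ) :
    ∫ z, (∑ j, traceEst A (fun i => z i * hadamardPrefix n k hk i j))
        ∂(MeasureTheory.Measure.pi fun _ : Fin (2 ^ n) => μ) = (2 : ℝ) ^ k * A.trace := by
  simp_rw [sum_traceEst_signed_hadamardPrefix hk A]
  rw [MeasureTheory.integral_const_mul, integral_dilutedTraceEst hμ]

end HadamardProbing

end StochasticTrace

end Literature.Probability.Moments
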